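import Summits.AtomisticToContinuum.BoseEinsteinCondensation.Theorems.BECGroundStateSOSPeriodicIRBoundDefs
import Summits.AtomisticToContinuum.BoseEinsteinCondensation.Theorems.BECGroundStateSOSPeriodicIRBoundWFDefs
import Literature.MathematicalPhysics.QuantumManyBody.PeriodicBoseGasMomentumSector
import Literature.MathematicalPhysics.QuantumManyBody.TorusFockLayer
import Literature.MathematicalPhysics.QuantumManyBody.PeriodicConfigFourier
import Literature.MathematicalPhysics.QuantumManyBody.PeriodicCondensateCoherence
import HarnessLib

/-! # Crux `PeriodicIRBound` (stmt-AtomisticToContinuum-3972), line `linear-ph-floor-wagner`, stub 5b `stub_wagnerFeynman` — Kinematics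
B3–B7, F1–F2: total momentum of `a_k Φ`, `a_k† Φ`; `‖a_kΦ‖² = N_k(Φ)`, `‖a_k†Φ‖² = ‖Φ‖² + N_k(Φ)`, `⟨n̂_kΦ, Φ⟩ = N_k(Φ)`; `N_k(f) ≤ M‖f‖²`. -/

/-!
# Kinematics of `a(φ)`, `a†(φ)`, `n̂ = a†a` for the smooth plane wave `φ = planeWaveMode L k`

* B3 `hasTotalMomentum_modeAn` — `aΦ` has total momentum `-p` when `Φ` has momentum `0`
  (`p = latticeVec (2π/L) k`): shift invariance of the cell integral of the periodic integrand.
* B4 `hasTotalMomentum_modeCr` — `a†Φ` has total momentum `p` when `Φ` has momentum `0` (algebra).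
* B5 `normSq_modeAn` — `‖aΦ‖² = n_k(Φ)` (`cellOccupation_eq_lintegral_modeAn`).
* B6 `normSq_modeCr` — `‖a†Φ‖² = ‖Φ‖² + n_k(Φ)` (adjointness `integral_conj_modeCr_mul` + CCR
  `modeAn_modeCr_apply`, `∫_cell |φ|² = 1`).
* B7 `integral_conj_numOp_mul` — `⟨n̂Φ, Φ⟩ = n_k(Φ)` as a complex integral identity.
* F1 `cellOccupation_le_mul_normSq` — `n_k(f) ≤ M ‖f‖²` (Parseval,
  `tsum_cellOccupation_planeWaveMode_eq`).
* F2 `cellOccupation_const_mul` — `n_k(c f) = |c|² n_k(f)`.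

The regularity facts needed here (continuity of `aΦ`, `a†Φ` and the Bose symmetry of `a†Φ`) are
proved as private lemmas (`continuous_modeAn_aux`, `continuous_modeCr_aux`, `isSymm_modeCr_aux`), so
that the file is self-contained and does not clash with the public API of `WFRegularity.lean`

invariance `setIntegral_cell_comp_add_of_periodic` of cell integrals of periodic integrands (B3).
-/

noncomputable section

open scoped BigOperators ENNReal ComplexConjugate
open Filter MeasureTheory

namespace Summit.AtomisticToContinuum.BoseEinsteinCondensation.Cruxes.PeriodicIRBound.LinearPhFloorWagner.WF

open Literature.MathematicalPhysics.QuantumManyBody.BoseGas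

variable {M n : ℕ} {L : ℝ}

/-! ## Auxiliary facts -/

/-- `a†Φ = modeCr φ Φ` is continuous for continuous `φ`, `Φ` (a finite sum of products of continuous
functions). -/
private theorem continuous_modeCr_aux {φ : Space → ℂ} (hφ : Continuous φ) {Φ : Config n → ℂ}
    (hΦ : Continuous Φ) : Continuous (modeCr φ Φ) := by
  change Continuous fun X : Config (n + 1) =>
    ((Real.sqrt (n + 1) : ℝ) : ℂ)⁻¹ * ∑ j : Fin (n + 1), φ (X j) * Φ (j.removeNth X)
  exact continuous_const.mul (continuous_finsetSum _ fun j _ =>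
    ((hφ.comp (continuous_apply j)).mul (hΦ.comp (continuous_removeNth j))))

/-- `aΦ = modeAn L φ Φ` is continuous for continuous `φ`, `Φ` (dominated convergence on the bounded
cell, with a locally uniform bound from compactness). Also proved in `WFRegularity.lean`. -/
private theorem continuous_modeAn_aux (L : ℝ) {φ : Space → ℂ} (hφ : Continuous φ)
    {Φ : Config (n + 1) → ℂ} (hΦ : Continuous Φ) : Continuous (modeAn L φ Φ) := by
  have hF : Continuous fun p : Config n × Space => conj (φ p.2) * Φ (Matrix.vecCons p.2 p.1) :=
    (Complex.continuous_conj.comp (hφ.comp continuous_snd)).mul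
      (hΦ.comp (continuous_snd.matrixVecCons continuous_fst))
  have hbdd : Bornology.IsBounded (cell L) :=
    (isCompact_closedBox L).isBounded.subset (cell_subset_closedBox L)
  change Continuous fun Y : Config n =>
    ((Real.sqrt (n + 1) : ℝ) : ℂ) * ∫ x in cell L, conj (φ x) * Φ (Matrix.vecCons x Y)
  refine continuous_const.mul (continuous_iff_continuousAt.2 fun Y₀ => ?_)
  obtain ⟨C, hC⟩ :=
    ((isCompact_closedBall Y₀ 1).prod hbdd.isCompact_closure).exists_bound_of_continuousOn
      hF.continuousOn
  refine continuousAt_of_dominated (bound := fun _ => C) ?_ ?_ ?_ ?_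
  · exact Eventually.of_forall fun Y => (hF.comp (Continuous.prodMk_right Y)).aestronglyMeasurable
  · filter_upwards [Metric.closedBall_mem_nhds Y₀ one_pos] with Y hY
    exact (ae_restrict_iff' (measurableSet_cell L)).2 (Eventually.of_forall fun x hx =>
      hC (Y, x) (Set.mk_mem_prod hY (subset_closure hx)))
  · exact integrableOn_const (by rw [volume_cell]; exact ENNReal.pow_ne_top ENNReal.ofReal_ne_top)
  · exact Eventually.of_forall fun x => (hF.comp (Continuous.prodMk_left x)).continuousAt

/-- Relabelling the remaining particles: for `σ ∈ 𝔖_{n+1}` and a slot `j` there is `τ ∈ 𝔖_n` with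
`(σ j).succAbove ∘ τ = σ ∘ j.succAbove`. -/
private theorem exists_perm_succAbove (σ : Equiv.Perm (Fin (n + 1))) (j : Fin (n + 1)) :
    ∃ τ : Equiv.Perm (Fin n), ∀ i, (σ j).succAbove (τ i) = σ (j.succAbove i) := by
  have hiff : ∀ a : Fin (n + 1), a ≠ j ↔ σ a ≠ σ j := fun a => σ.injective.ne_iff.symm
  refine ⟨(finSuccAboveEquiv j).trans ((σ.subtypeEquiv hiff).trans (finSuccAboveEquiv (σ j)).symm),
    fun i => ?_⟩
  exact congrArg Subtype.val
    ((finSuccAboveEquiv (σ j)).apply_symm_apply (σ.subtypeEquiv hiff (finSuccAboveEquiv j i)))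

/-- `a†Φ = modeCr φ Φ` is Bose-symmetric when `Φ` is (relabel the sum over the slots by `σ` and the
remaining particles by `exists_perm_succAbove`). Also proved in `WFRegularity.lean`. -/
private theorem isSymm_modeCr_aux {φ : Space → ℂ} {Φ : Config n → ℂ} (hΦ : IsSymm Φ) :
    IsSymm (modeCr φ Φ) := by
  intro σ X
  rw [modeCr_apply, modeCr_apply, ← Equiv.sum_comp σ (fun j => φ (X j) * Φ (j.removeNth X))]
  congr 1
  refine Finset.sum_congr rfl fun j _ => ?_
  obtain ⟨τ, hτ⟩ := exists_perm_succAbove σ j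
  have h : j.removeNth (X ∘ σ) = (σ j).removeNth X ∘ τ := by
    funext i
    simp only [Fin.removeNth, Function.comp_apply, hτ]
  rw [h]
  change φ (X (σ j)) * Φ ((σ j).removeNth X ∘ τ) = φ (X (σ j)) * Φ ((σ j).removeNth X)
  rw [hΦ]

/-- The smooth plane waves are measurable. -/
private theorem measurable_planeWaveMode (L : ℝ) (k : Fin 3 → ℤ) :
    Measurable (planeWaveMode L k) :=
  (continuous_planeWaveMode L k).measurable

/-- The smooth plane waves are bounded by `L^{-3/2}`. -/
private theorem norm_planeWaveMode_le_kin (L : ℝ) (k : Fin 3 → ℤ) (x : Space) :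
    ‖planeWaveMode L k x‖ ≤ (Real.sqrt (L ^ 3))⁻¹ :=
  (norm_planeWaveMode L k x).le

/-- `∫_cell conj(φ_k) φ_k = 1`: the plane waves are normalised on the cell. -/
private theorem integral_conj_planeWaveMode_mul_self (hL : 0 < L) (k : Fin 3 → ℤ) :
    ∫ x in cell L, conj (planeWaveMode L k x) * planeWaveMode L k x = 1 := by
  have h : ∀ x, conj (planeWaveMode L k x) * planeWaveMode L k x = (((L ^ 3)⁻¹ : ℝ) : ℂ) := by
    intro x
    rw [Complex.conj_mul', norm_planeWaveMode, ← Complex.ofReal_pow, inv_pow,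
      Real.sq_sqrt (by positivity)]
  simp_rw [h]
  rw [setIntegral_const, measureReal_def, volume_cell, ENNReal.toReal_pow,
    ENNReal.toReal_ofReal hL.le, Complex.real_smul, ← Complex.ofReal_mul,
    mul_inv_cancel₀ (pow_ne_zero 3 hL.ne'), Complex.ofReal_one]

/-- `‖g‖² = ofReal (∫ ‖g‖²)` for a continuous `g` (finite Bochner integral on the bounded cell). -/
private theorem normSq_eq_ofReal {g : Config M → ℂ} (hg : Continuous g) :
    normSq L g = ENNReal.ofReal (∫ X in cellN M L, ‖g X‖ ^ 2) := by
  rw [normSq, ofReal_integral_eq_lintegral_ofReal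
    (integrableOn_cellN (f := fun X => ‖g X‖ ^ 2) (hg.norm.pow 2) L)
    (Eventually.of_forall fun X => sq_nonneg _)]
  exact lintegral_congr fun X => coe_nnnorm_sq_eq_ofReal _

/-- `‖g‖² < ∞` for a continuous `g`. -/
private theorem normSq_ne_top_kin {g : Config M → ℂ} (hg : Continuous g) : normSq L g ≠ ⊤ := by
  rw [normSq_eq_ofReal hg]
  exact ENNReal.ofReal_ne_top

/-- `∫ conj(g) g = ‖g‖²` (as a complex number) for a continuous `g`. -/
private theorem integral_conj_mul_self {g : Config M → ℂ} (hg : Continuous g) :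
    ∫ X in cellN M L, conj (g X) * g X = ((normSq L g).toReal : ℂ) := by
  simp_rw [Complex.conj_mul', ← Complex.ofReal_pow]
  rw [integral_complex_ofReal, normSq_eq_ofReal hg,
    ENNReal.toReal_ofReal (integral_nonneg fun X => sq_nonneg _)]

/-! ## §B Kinematics -/

/-- B3: momentum of `aΦ` is `-p` when `Φ` has momentum `0`. -/
theorem hasTotalMomentum_modeAn (hL : 0 < L) (k : Fin 3 → ℤ) {Φ : Config (n + 1) → ℂ} (hΦ : IsCore L Φ)
    (h0 : HasTotalMomentum 0 Φ) :
    HasTotalMomentum (-latticeVec (2 * Real.pi / L) k) (modeAn L (planeWaveMode L k) Φ) := by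
  rw [hasTotalMomentum_zero_iff] at h0
  intro s Y
  -- the phase picked up by the mode under the translation by `s`
  obtain ⟨E, hE⟩ : ∃ E : ℂ,
      E = Complex.exp (Complex.I * ↑(∑ j, (latticeVec (2 * Real.pi / L) k) j * s j)) := ⟨_, rfl⟩
  have hmode : ∀ x : Space, planeWaveMode L k (x + s) = E * planeWaveMode L k x := by
    intro x
    have h : cellWave L k (x + s) = E * cellWave L k x := by
      rw [hE]; exact hasTotalMomentum_cellWave L k (0 : Fin 1) s (fun _ => x)
    rw [planeWaveMode_eq, planeWaveMode_eq, h]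
    ring
  have hconj : conj E =
      Complex.exp (Complex.I * ↑(∑ j, (-latticeVec (2 * Real.pi / L) k) j * s j)) := by
    rw [hE, ← Complex.exp_conj, map_mul, Complex.conj_I, Complex.conj_ofReal]
    congr 1
    have hsum : (∑ j, (-latticeVec (2 * Real.pi / L) k) j * s j) =
        -∑ j, (latticeVec (2 * Real.pi / L) k) j * s j := by
      rw [← Finset.sum_neg_distrib]
      exact Finset.sum_congr rfl fun j _ => by rw [PiLp.neg_apply]; ring
    rw [hsum, Complex.ofReal_neg]
    ring
  -- translating all particles: `Φ(x, Y + s) = Φ(x - s, Y)`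
  have hslice : ∀ x : Space,
      Φ (Matrix.vecCons x fun i => Y i + s) = Φ (Matrix.vecCons (x + -s) Y) := by
    intro x
    have h : (Matrix.vecCons x fun i => Y i + s : Config (n + 1)) =
        fun i => Matrix.vecCons (x + -s) Y i + s := by
      funext i
      refine Fin.cases ?_ (fun j => ?_) i
      · simp
      · simp
    rw [h]
    exact h0 s _
  -- the periodic integrand `H(u) = conj φ(u + s) Φ(u, Y)`
  obtain ⟨H, hH⟩ : ∃ H : Space → ℂ,
      H = fun u => conj (planeWaveMode L k (u + s)) * Φ (Matrix.vecCons u Y) := ⟨_, rfl⟩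
  have hper : ∀ (x : Space) (c : Fin 3), H (x + EuclideanSpace.single c L) = H x := by
    intro x c
    simp only [hH]
    rw [add_right_comm, planeWaveMode_periodic hL.ne']
    have h : (Matrix.vecCons (x + EuclideanSpace.single c L) Y : Config (n + 1)) =
        Matrix.vecCons x Y + Pi.single (0 : Fin (n + 1)) (EuclideanSpace.single c L) := by
      funext i
      refine Fin.cases ?_ (fun j => ?_) i
      · simp
      · simp
    rw [h, hΦ.periodic]
  have hint : ∀ x : Space,
      conj (planeWaveMode L k x) * Φ (Matrix.vecCons x fun i => Y i + s) = H (x + -s) := by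
    intro x
    simp only [hH, hslice x, neg_add_cancel_right]
  have key : ∫ x in cell L, conj (planeWaveMode L k x) * Φ (Matrix.vecCons x fun i => Y i + s) =
      conj E * ∫ x in cell L, conj (planeWaveMode L k x) * Φ (Matrix.vecCons x Y) := by
    calc ∫ x in cell L, conj (planeWaveMode L k x) * Φ (Matrix.vecCons x fun i => Y i + s)
        = ∫ x in cell L, H (x + -s) := integral_congr_ae (Eventually.of_forall hint)
      _ = ∫ x in cell L, H x := setIntegral_cell_comp_add_of_periodic hL hper (-s)
      _ = ∫ x in cell L, conj E * (conj (planeWaveMode L k x) * Φ (Matrix.vecCons x Y)) := by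
          refine integral_congr_ae (Eventually.of_forall fun x => ?_)
          simp only [hH, hmode, map_mul, mul_assoc]
      _ = conj E * ∫ x in cell L, conj (planeWaveMode L k x) * Φ (Matrix.vecCons x Y) :=
          integral_const_mul _ _
  rw [modeAn_apply, modeAn_apply, key, ← hconj]
  ring

/-- B4: momentum of `a†Φ` is `p` when `Φ` has momentum `0`. -/
theorem hasTotalMomentum_modeCr (k : Fin 3 → ℤ) {Φ : Config n → ℂ} (h0 : HasTotalMomentum 0 Φ) :
    HasTotalMomentum (latticeVec (2 * Real.pi / L) k) (modeCr (planeWaveMode L k) Φ) := by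
  have h : modeCr (planeWaveMode L k) Φ = fun X : Config (n + 1) =>
      ((Real.sqrt (n + 1) : ℝ) : ℂ)⁻¹ *
        ∑ j : Fin (n + 1), planeWaveMode L k (X j) * Φ (j.removeNth X) := rfl
  rw [h]
  refine HasTotalMomentum.const_mul (HasTotalMomentum.sum Finset.univ fun j _ => ?_) _
  have h1 : HasTotalMomentum (latticeVec (2 * Real.pi / L) k)
      fun X : Config (n + 1) => planeWaveMode L k (X j) := by
    have h := (hasTotalMomentum_cellWave L k j (M := n + 1)).const_mul ((Real.sqrt (L ^ 3))⁻¹ : ℂ)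
    have heq : (fun X : Config (n + 1) => planeWaveMode L k (X j)) =
        fun X : Config (n + 1) => ((Real.sqrt (L ^ 3))⁻¹ : ℂ) * cellWave L k (X j) :=
      funext fun X => planeWaveMode_eq L k (X j)
    rw [heq]
    exact h
  have h2 : HasTotalMomentum 0 fun X : Config (n + 1) => Φ (j.removeNth X) := by
    rw [hasTotalMomentum_zero_iff] at h0 ⊢
    intro s X
    exact h0 s (j.removeNth X)
  have h12 := h1.mul h2
  rwa [add_zero] at h12

/-- B5: `‖aΦ‖² = n_k(Φ)` (`cellOccupation_eq_lintegral_modeAn`; `planeWaveMode = planeWave` on the cell). -/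
theorem normSq_modeAn (hL : 0 < L) (k : Fin 3 → ℤ) (Φ : Config (n + 1) → ℂ) :
    normSq L (modeAn L (planeWaveMode L k) Φ) = cellOccupation (n + 1) L (planeWaveMode L k) Φ := by
  have _ := hL -- the identity holds for every `L`
  exact (cellOccupation_eq_lintegral_modeAn L _ Φ).symm

/-- B6: `‖a†Φ‖² = ‖Φ‖² + n_k(Φ)` for a core `Φ` (adjointness `integral_conj_modeCr_mul` + CCR
`modeAn_modeCr_apply`; `∫_cell |φ|² = 1`). -/
theorem normSq_modeCr (hL : 0 < L) (k : Fin 3 → ℤ) {Φ : Config (n + 1) → ℂ} (hΦ : IsCore L Φ) :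
    normSq L (modeCr (planeWaveMode L k) Φ) = normSq L Φ + cellOccupation (n + 1) L (planeWaveMode L k) Φ := by
  have hφm := measurable_planeWaveMode L k
  have hφb := norm_planeWaveMode_le_kin L k
  have hφc := continuous_planeWaveMode L k
  have hΦc : Continuous Φ := hΦ.contDiff.continuous
  have hAc : Continuous (modeAn L (planeWaveMode L k) Φ) := continuous_modeAn_aux L hφc hΦc
  have hCc : Continuous (modeCr (planeWaveMode L k) Φ) := continuous_modeCr_aux hφc hΦc
  have hCs : IsSymm (modeCr (planeWaveMode L k) Φ) := isSymm_modeCr_aux hΦ.symm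
  -- slices are integrable against the mode
  have hsl : ∀ Z : Config n, IntegrableOn
      (fun x => conj (planeWaveMode L k x) * Φ (Matrix.vecCons x Z)) (cell L) := fun Z =>
    integrableOn_cell_conj_mul hφm hφb (hΦc.comp (continuous_id.matrixVecCons continuous_const))
  -- the CCR, pointwise: `a a† Φ = Φ + a† a Φ`
  have hccr : ∀ Y, modeAn L (planeWaveMode L k) (modeCr (planeWaveMode L k) Φ) Y =
      Φ Y + modeCr (planeWaveMode L k) (modeAn L (planeWaveMode L k) Φ) Y := by
    intro Y
    rw [modeAn_modeCr_apply (integrableOn_cell_conj_mul hφm hφb hφc) hsl,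
      integral_conj_planeWaveMode_mul_self hL, one_mul]
  have hi1 : IntegrableOn (fun Y => conj (Φ Y) * Φ Y) (cellN (n + 1) L) :=
    integrableOn_cellN ((Complex.continuous_conj.comp hΦc).mul hΦc) L
  have hi2 : IntegrableOn
      (fun Y => conj (Φ Y) * modeCr (planeWaveMode L k) (modeAn L (planeWaveMode L k) Φ) Y)
      (cellN (n + 1) L) :=
    integrableOn_cellN ((Complex.continuous_conj.comp hΦc).mul (continuous_modeCr_aux hφc hAc)) L
  -- the complex identity `⟨a†Φ, a†Φ⟩ = ⟨Φ, Φ⟩ + ⟨aΦ, aΦ⟩`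
  have key : ((normSq L (modeCr (planeWaveMode L k) Φ)).toReal : ℂ) =
      ((normSq L Φ).toReal : ℂ) + ((normSq L (modeAn L (planeWaveMode L k) Φ)).toReal : ℂ) := by
    rw [← integral_conj_mul_self hCc, ← integral_conj_mul_self hΦc, ← integral_conj_mul_self hAc,
      integral_conj_modeCr_mul hφm hφb hΦc hCc hCs]
    simp_rw [hccr, mul_add]
    rw [integral_add hi1 hi2, integral_conj_modeAn_mul hφm hφb hAc hΦc hΦ.symm]
  -- back to `ℝ≥0∞`
  rw [← normSq_modeAn hL k Φ]
  have h1 := normSq_ne_top_kin (L := L) hCc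
  have h2 := normSq_ne_top_kin (L := L) hΦc
  have h3 := normSq_ne_top_kin (L := L) hAc
  rw [← ENNReal.toReal_eq_toReal_iff' h1 (ENNReal.add_ne_top.2 ⟨h2, h3⟩), ENNReal.toReal_add h2 h3]
  exact_mod_cast key

/-- B7: `⟨n̂Φ, Φ⟩ = ‖aΦ‖²` (real, `= n_k(Φ)`), as a complex integral identity. -/
theorem integral_conj_numOp_mul (hL : 0 < L) (k : Fin 3 → ℤ) {Φ : Config (n + 1) → ℂ} (hΦ : IsCore L Φ) :
    ∫ X in cellN (n + 1) L, conj (modeCr (planeWaveMode L k) (modeAn L (planeWaveMode L k) Φ) X) * Φ X =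
      ((cellOccupation (n + 1) L (planeWaveMode L k) Φ).toReal : ℂ) := by
  have hΦc : Continuous Φ := hΦ.contDiff.continuous
  have hAc : Continuous (modeAn L (planeWaveMode L k) Φ) :=
    continuous_modeAn_aux L (continuous_planeWaveMode L k) hΦc
  rw [integral_conj_modeCr_mul (measurable_planeWaveMode L k) (norm_planeWaveMode_le_kin L k) hAc hΦc
    hΦ.symm, integral_conj_mul_self hAc, normSq_modeAn hL k Φ]

/-! ## §F Occupation bookkeeping -/

/-- F1: `n_k(f) ≤ M ‖f‖²` for continuous `f` (`∑_q n_q = M‖f‖²`, `tsum_cellOccupation_planeWaveMode_eq`). -/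
theorem cellOccupation_le_mul_normSq (hL : 0 < L) (k : Fin 3 → ℤ) {f : Config M → ℂ} (hf : Continuous f) :
    cellOccupation M L (planeWaveMode L k) f ≤ (M : ℝ≥0∞) * normSq L f := by
  rw [normSq, ← tsum_cellOccupation_planeWaveMode_eq hL hf]
  exact ENNReal.le_tsum k

/-- Occupations scale quadratically, for every mode `φ`: `n_φ(c f) = |c|² n_φ(f)`. -/
theorem cellOccupation_const_mul_mode (L : ℝ) (φ : Space → ℂ) (c : ℂ) (f : Config M → ℂ) :
    cellOccupation M L φ (fun X => c * f X) = (‖c‖₊ : ℝ≥0∞) ^ 2 * cellOccupation M L φ f := by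
  cases M with
  | zero => simp [cellOccupation, occupation]
  | succ m =>
    rw [cellOccupation_succ, cellOccupation_succ]
    have h : ∀ Y : Config m,
        (∫ x in cell L, conj (φ x) * (c * f (Matrix.vecCons x Y))) =
          c * ∫ x in cell L, conj (φ x) * f (Matrix.vecCons x Y) := by
      intro Y
      rw [← integral_const_mul]
      exact integral_congr_ae (Eventually.of_forall fun x => by ring)
    simp_rw [h, nnnorm_mul, ENNReal.coe_mul, mul_pow]
    rw [lintegral_const_mul' _ _ (ENNReal.pow_ne_top ENNReal.coe_ne_top)]
    ring

/-- F2: occupations scale quadratically: `n_k(c f) = |c|² n_k(f)`. -/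
theorem cellOccupation_const_mul (L : ℝ) (k : Fin 3 → ℤ) (c : ℂ) (f : Config M → ℂ) :
    cellOccupation M L (planeWaveMode L k) (fun X => c * f X) =
      (‖c‖₊ : ℝ≥0∞) ^ 2 * cellOccupation M L (planeWaveMode L k) f :=
  cellOccupation_const_mul_mode L _ c f

end Summit.AtomisticToContinuum.BoseEinsteinCondensation.Cruxes.PeriodicIRBound.LinearPhFloorWagner.WF

end

namespace Summit.AtomisticToContinuum.BoseEinsteinCondensation.Cruxes.PeriodicIRBound.LinearPhFloorWagner

/-- The registered sub-goal `stub_wfKinematics` of the crux ledger: this file's headline lemma `WF.normSq_modeAn`. -/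
theorem stub_wfKinematics : WF.Pkg.Kinematics :=
  @WF.normSq_modeAn

end Summit.AtomisticToContinuum.BoseEinsteinCondensation.Cruxes.PeriodicIRBound.LinearPhFloorWagner
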